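import Summits.HubbardSuperconductivity.HubbardSuperconductivity.Theorems.BalabanIRBirGroundStateAverageLROBounds
import Literature.MathematicalPhysics.QuantumLattice.HubbardGrandCanonicalDensity
import Literature.MathematicalPhysics.QuantumLattice.FinDimSpectrumSectorGibbsLimit

/-!
# Crux `BirGroundStateAverageLRO` (item `stmt-HubbardSuperconductivity-2079`): load-bearing analysis

The crux (`Theses.BalabanIR.BirGroundStateAverageLRO`, route BalabanIR, target / rank 0) is
`∃ δ ∈ (0,1/2), ∃ 0 < U₁ < U₂, ∃ c > 0, ∀ U ∈ (U₁,U₂), ∃ L₀, ∀ even L ≥ L₀: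
c·L⁴·Re tr P ≤ Re tr (P Δ_d†Δ_d)` for the projection `P` onto the ground eigenspace of
`hubbardTorus 2 L 1 U` in the sector `(2⌊(1-δ)L²/2⌋, S^z = 0)`, `Δ_d = pairField dWaveFormFactor L`.
Negative-side lemmas of the standing disprover (cdisprove cycle 1; NO definition is introduced, every
mutated statement is spelled out; nothing here asserts a Theses decl positively):

* `birGroundStateAverageLRO_const_le` / `not_birGroundStateAverageLRO_with_large_const` — TIGHTNESS:
  any admissible constant has `c ≤ 32` (the crude norm constant of `Δ_d` is `≤ 4√2`, the tree's
  `re_trace_sectorGroundProj_mul_pairField_mem_Icc` and `re tr P ≥ 1`); the crux with `32 < c` is false.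
* `birGroundStateAverageLRO_window_floor` — LOAD-BEARING `0 < U₁`: if the average bound with
  constant `c` holds eventually in even `L` at every coupling of `(U₁, U₂)`, `U₁ ≥ 0`, and `η` is an
  energy-cost rate for `d`-wave pair LRO of density `c` in the FREE Fermi sea (a unit sector vector
  with `Re ⟨ψ, Δ_d†Δ_d ψ⟩ ≥ c L⁴` has free energy `≥` free sector ground energy `+ η L²`, all large
  `L`), then `η ≤ U₁`. Mechanism (`re_free_energy_groundState_le`): an interacting sector ground state
  at coupling `U ≥ 0` has free energy excess `≤ U·L²` (variational principle against a free sector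
  ground state, `0 ≤ Σ_x n_{x↑}n_{x↓} ≤ L²`).
* `not_birGroundStateAverageLRO_fromZero_of_pairingCost` — hence, granted the free-fermion
  energy inequality for every density `a > 0` (BCS asymptotics; hypothesis spelled inline), the
  STRENGTHENING of the crux with window `(0, U₂)` and a constant uniform down to `U → 0⁺` is FALSE:
  the crux rightly asks `0 < U₁` and lets `c` depend on the window (`c(U₁) → 0`, on paper
  `≲ U₁ log(1/U₁)`), in line with `Literature.Barriers.HubbardSuperconductivity.PerturbativeInvisibilityOfPairing`.

Workfile with the full attack log (near-misses, regime map, literature):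
`Cruxes/BirGroundStateAverageLRO/Disproof.lean`. Sources: Scalapino, Phys. Rep. 250 (1995) §2
(pair field); Tasaki (2020) §2.2 (variational principle); Bardeen–Cooper–Schrieffer (1957) and
Bru–de Siqueira Pedra, Mem. AMS 224 (2013) App., Thm 107 (BCS mean-field asymptotics behind the
inline hypothesis, which is NOT asserted here).
-/

noncomputable section

namespace Summit.HubbardSuperconductivity.HubbardSuperconductivity.Theorems.BirGroundStateAverageLRO.Negative

open Matrix Finset Filter
open Literature.Probability.LatticeModels Literature.MathematicalPhysics.QuantumLattice
open Summit.HubbardSuperconductivity.HubbardSuperconductivity.Theorems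
open scoped ComplexOrder

/-! ### Tightness of the constant: `c ≤ 32` -/

/-- The crude norm constant `C_d = Σ_{e ∈ {0} ∪ unitSteps} 2|g_d e|/√2` of `Δ_d` is at most `4√2`
(four unit steps, each contributing `≤ √2` since `|g_d| ≤ 1`; the `e = 0` term vanishes).
Scalapino, Phys. Rep. 250 (1995) 329, §2. [folklore] -/
theorem dWave_normConst_le :
    (∑ e ∈ insert 0 unitSteps, ‖((dWaveFormFactor e / Real.sqrt 2 : ℝ) : ℂ)‖ * 2) ≤
      4 * Real.sqrt 2 := by
  have hs2 : 0 < Real.sqrt 2 := Real.sqrt_pos.2 (by norm_num)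
  have hterm : ∀ e : Site 2, ‖((dWaveFormFactor e / Real.sqrt 2 : ℝ) : ℂ)‖ * 2 ≤ Real.sqrt 2 := by
    intro e
    rw [Complex.norm_real, Real.norm_eq_abs, abs_div, abs_of_pos hs2, div_mul_eq_mul_div,
      div_le_iff₀ hs2, Real.mul_self_sqrt (by norm_num : (0:ℝ) ≤ 2)]
    -- `|g_d(e)| ≤ 1` (also `Theorems.abs_dWaveFormFactor_le_one` of the ThermalWedge support
    -- file, not imported here to keep this file free of a second route's Theses module)
    have hg : |dWaveFormFactor e| ≤ 1 := by
      unfold dWaveFormFactor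
      split_ifs <;> norm_num
    linarith
  have h0 : ‖((dWaveFormFactor 0 / Real.sqrt 2 : ℝ) : ℂ)‖ * 2 = 0 := by simp
  rw [Finset.sum_insert_zero
    (f := fun e : Site 2 => ‖((dWaveFormFactor e / Real.sqrt 2 : ℝ) : ℂ)‖ * 2) h0]
  have hcard : (unitSteps).card ≤ 4 := by
    unfold unitSteps
    refine (Finset.card_insert_le _ _).trans ?_
    refine Nat.succ_le_succ ((Finset.card_insert_le _ _).trans ?_)
    refine Nat.succ_le_succ ((Finset.card_insert_le _ _).trans ?_)
    simp
  calc (∑ e ∈ unitSteps, ‖((dWaveFormFactor e / Real.sqrt 2 : ℝ) : ℂ)‖ * 2)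
      ≤ ∑ _e ∈ unitSteps, Real.sqrt 2 := Finset.sum_le_sum fun e _ => hterm e
    _ = (unitSteps.card : ℝ) * Real.sqrt 2 := by rw [Finset.sum_const, nsmul_eq_mul]
    _ ≤ 4 * Real.sqrt 2 := by
        have : (unitSteps.card : ℝ) ≤ 4 := by exact_mod_cast hcard
        nlinarith

/-- `C_d² ≤ 32`. [folklore] -/
theorem dWave_normConst_sq_le :
    (∑ e ∈ insert 0 unitSteps, ‖((dWaveFormFactor e / Real.sqrt 2 : ℝ) : ℂ)‖ * 2) ^ 2 ≤ 32 := by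
  have h := dWave_normConst_le
  have h0 : 0 ≤ ∑ e ∈ insert 0 unitSteps, ‖((dWaveFormFactor e / Real.sqrt 2 : ℝ) : ℂ)‖ * 2 :=
    Finset.sum_nonneg fun e _ => by positivity
  calc (∑ e ∈ insert 0 unitSteps, ‖((dWaveFormFactor e / Real.sqrt 2 : ℝ) : ℂ)‖ * 2) ^ 2
      ≤ (4 * Real.sqrt 2) ^ 2 := pow_le_pow_left₀ h0 h 2
    _ = 32 := by
        rw [mul_pow, Real.sq_sqrt (by norm_num : (0:ℝ) ≤ 2)]
        norm_num

/-- **One instance of the average bound forces `c ≤ 32`.** If at some side `L ≥ 1`, coupling `U`,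
hopping `t` and `δ ≥ -1` the crux's inequality `c·L⁴·Re tr P ≤ Re tr (P Δ_d†Δ_d)` holds, then
`c ≤ 32`: `Re tr (P Δ_d†Δ_d) ≤ C_d² L⁴ Re tr P ≤ 32 L⁴ Re tr P` and `Re tr P ≥ 1`. [folklore] -/
theorem const_le_of_avgBound (L : ℕ) [NeZero L] (t U δ c : ℝ) (hδ : -1 ≤ δ) :
    let N : ℕ := 2 * ⌊(1 - δ) * (L : ℝ) ^ 2 / 2⌋₊
    let H := hubbardTorus 2 L t U
    let S := szSector (Λ := FermionTorus 2 L) N 0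
    let E₀ := S ⊓ Module.End.eigenspace (Matrix.toLin' H) ((H.minEnergyOn S : ℝ) : ℂ)
    let P := projMatrix (E₀.map (Fock.toEuclidean (ι := Orb (FermionTorus 2 L)) :
      Fock (Orb (FermionTorus 2 L)) →ₗ[ℂ] EuclideanSpace ℂ (Finset (Orb (FermionTorus 2 L)))))
    c * (L : ℝ) ^ 4 * P.trace.re ≤
        (P * ((pairField dWaveFormFactor L)ᴴ * pairField dWaveFormFactor L)).trace.re →
      c ≤ 32 := by
  intro N H S E₀ P h
  have hP : 1 ≤ P.trace.re := one_le_re_trace_groundProj_hubbardTorus L t U δ hδ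
  have hup : (P * ((pairField dWaveFormFactor L)ᴴ * pairField dWaveFormFactor L)).trace.re ≤
      ((∑ e ∈ insert 0 unitSteps, ‖((dWaveFormFactor e / Real.sqrt 2 : ℝ) : ℂ)‖ * 2) *
        (L : ℝ) ^ 2) ^ 2 * P.trace.re :=
    (re_trace_sectorGroundProj_mul_pairField_mem_Icc dWaveFormFactor L H N 0).2
  have hL : (0 : ℝ) < (L : ℝ) ^ 4 := by
    have : (0 : ℝ) < (L : ℝ) := by exact_mod_cast Nat.pos_of_ne_zero (NeZero.ne L)
    positivity
  have hC := dWave_normConst_sq_le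
  have h1 : c * (L : ℝ) ^ 4 * P.trace.re ≤ 32 * (L : ℝ) ^ 4 * P.trace.re := by
    refine h.trans (hup.trans ?_)
    have heq : ((∑ e ∈ insert 0 unitSteps, ‖((dWaveFormFactor e / Real.sqrt 2 : ℝ) : ℂ)‖ * 2) *
        (L : ℝ) ^ 2) ^ 2 = (∑ e ∈ insert 0 unitSteps,
          ‖((dWaveFormFactor e / Real.sqrt 2 : ℝ) : ℂ)‖ * 2) ^ 2 * (L : ℝ) ^ 4 := by ring
    rw [heq]
    have hL4T : 0 ≤ (L : ℝ) ^ 4 * P.trace.re := by nlinarith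
    nlinarith
  have hLT : 0 < (L : ℝ) ^ 4 * P.trace.re := by nlinarith
  nlinarith

/-- **Tightness of `BirGroundStateAverageLRO`: every witness has `c ≤ 32`.** If `(δ, U₁, U₂, c)`
satisfies the window clause of the crux (`δ ∈ (0,1/2)`, `U₁ < U₂`, the average bound eventually in
even `L` at every `U ∈ (U₁, U₂)`), then `c ≤ 32`. [folklore] -/
theorem birGroundStateAverageLRO_const_le {δ U₁ U₂ c : ℝ} (hδ : δ ∈ Set.Ioo (0:ℝ) (1/2))
    (hU : U₁ < U₂)
    (h : ∀ U ∈ Set.Ioo U₁ U₂, ∃ L₀ : ℕ, ∀ (L : ℕ) [NeZero L], L₀ ≤ L → Even L →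
      let N : ℕ := 2 * ⌊(1 - δ) * (L : ℝ) ^ 2 / 2⌋₊
      let H := hubbardTorus 2 L 1 U
      let S := szSector (Λ := FermionTorus 2 L) N 0
      let E₀ := S ⊓ Module.End.eigenspace (Matrix.toLin' H) ((H.minEnergyOn S : ℝ) : ℂ)
      let P := projMatrix (E₀.map (Fock.toEuclidean (ι := Orb (FermionTorus 2 L)) :
        Fock (Orb (FermionTorus 2 L)) →ₗ[ℂ] EuclideanSpace ℂ (Finset (Orb (FermionTorus 2 L)))))
      c * (L : ℝ) ^ 4 * P.trace.re ≤
        (P * ((pairField dWaveFormFactor L)ᴴ * pairField dWaveFormFactor L)).trace.re) :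
    c ≤ 32 := by
  obtain ⟨L₀, hL₀⟩ := h ((U₁ + U₂) / 2) ⟨by linarith, by linarith⟩
  haveI : NeZero (2 * (L₀ + 1)) := ⟨by omega⟩
  exact const_le_of_avgBound (2 * (L₀ + 1)) 1 ((U₁ + U₂) / 2) δ c (by linarith [hδ.1])
    (hL₀ (2 * (L₀ + 1)) (by omega) (even_two_mul _))

/-- **Refuted strengthening (constant).** `BirGroundStateAverageLRO` with `0 < c` replaced by
`32 < c` is FALSE. [folklore] -/
theorem not_birGroundStateAverageLRO_with_large_const :
    ¬ ∃ δ ∈ Set.Ioo (0:ℝ) (1/2), ∃ U₁ U₂ c : ℝ, 0 < U₁ ∧ U₁ < U₂ ∧ 32 < c ∧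
        ∀ U ∈ Set.Ioo U₁ U₂, ∃ L₀ : ℕ, ∀ (L : ℕ) [NeZero L], L₀ ≤ L → Even L →
          let N : ℕ := 2 * ⌊(1 - δ) * (L : ℝ) ^ 2 / 2⌋₊
          let H := hubbardTorus 2 L 1 U
          let S := szSector (Λ := FermionTorus 2 L) N 0
          let E₀ := S ⊓ Module.End.eigenspace (Matrix.toLin' H) ((H.minEnergyOn S : ℝ) : ℂ)
          let P := projMatrix (E₀.map (Fock.toEuclidean (ι := Orb (FermionTorus 2 L)) :
            Fock (Orb (FermionTorus 2 L)) →ₗ[ℂ]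
              EuclideanSpace ℂ (Finset (Orb (FermionTorus 2 L)))))
          c * (L : ℝ) ^ 4 * P.trace.re ≤
            (P * ((pairField dWaveFormFactor L)ᴴ * pairField dWaveFormFactor L)).trace.re := by
  rintro ⟨δ, hδ, U₁, U₂, c, -, hU, hc, h⟩
  have := birGroundStateAverageLRO_const_le hδ hU h
  linarith

/-! ### Energy bookkeeping: `H(t,U) = H(t,0) + U·Σ_x n_{x↑}n_{x↓}` and `0 ≤ Σ_x n_{x↑}n_{x↓} ≤ |Λ|` -/

section Energy

variable {Λ : Type*} [LinearOrder Λ] [Fintype Λ] (G : SimpleGraph Λ) [DecidableRel G.Adj]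

/-- `H(t,U) = H(t,0) + U·Σ_x n_{x↑} n_{x↓}` (the tree's `hamiltonianWith_sub_hamiltonianWith` at
`μ = 0`). Lieb, PRL 62 (1989) 1201. [folklore] -/
theorem hamiltonian_eq_free_add_interaction (t U : ℝ) :
    hamiltonian G t U = hamiltonian G t 0 +
      (U : ℂ) • (∑ x : Λ, numberOp x 0 * numberOp x 1 : Matrix (Finset (Orb Λ)) _ ℂ) := by
  have h := hamiltonianWith_sub_hamiltonianWith G t 0 U 0
  simp only [hamiltonianWith_zero, sub_zero] at h
  rw [← h]
  abel

/-- `Re ⟨ψ, H(t,U) ψ⟩ = Re ⟨ψ, H(t,0) ψ⟩ + U · Re ⟨ψ, Σ_x n_{x↑}n_{x↓} ψ⟩`. [folklore] -/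
theorem re_expect_hamiltonian_eq (t U : ℝ) (ψ : Fock (Orb Λ)) :
    (star ψ ⬝ᵥ hamiltonian G t U *ᵥ ψ).re =
      (star ψ ⬝ᵥ hamiltonian G t 0 *ᵥ ψ).re +
        U * (star ψ ⬝ᵥ
          (∑ x : Λ, numberOp x 0 * numberOp x 1 : Matrix (Finset (Orb Λ)) _ ℂ) *ᵥ ψ).re := by
  rw [hamiltonian_eq_free_add_interaction G t U, add_mulVec, smul_mulVec, dotProduct_add,
    dotProduct_smul, smul_eq_mul, Complex.add_re, Complex.re_ofReal_mul]

omit [Fintype Λ] in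
/-- `0 ≤ Re ⟨ψ, Σ_x n_{x↑}n_{x↓} ψ⟩` (the interaction is a positive operator,
`posSemidef_sum_numberOp_mul_numberOp`). [folklore] -/
theorem re_expect_interaction_nonneg [Fintype Λ] (ψ : Fock (Orb Λ)) :
    0 ≤ (star ψ ⬝ᵥ
      (∑ x : Λ, numberOp x 0 * numberOp x 1 : Matrix (Finset (Orb Λ)) _ ℂ) *ᵥ ψ).re := by
  have h := (posSemidef_sum_numberOp_mul_numberOp (Λ := Λ)).dotProduct_mulVec_nonneg ψ
  exact (Complex.nonneg_iff.1 h).1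

omit [Fintype Λ] in
/-- `Re ⟨ψ, Σ_x n_{x↑}n_{x↓} ψ⟩ ≤ |Λ| · Re ⟨ψ, ψ⟩` (at most one doubly occupied pair per site,
`posSemidef_card_sub_sum_numberOp_mul_numberOp`). [folklore] -/
theorem re_expect_interaction_le [Fintype Λ] (ψ : Fock (Orb Λ)) :
    (star ψ ⬝ᵥ
      (∑ x : Λ, numberOp x 0 * numberOp x 1 : Matrix (Finset (Orb Λ)) _ ℂ) *ᵥ ψ).re ≤
      (Fintype.card Λ : ℝ) * (star ψ ⬝ᵥ ψ).re := by
  have h := (posSemidef_card_sub_sum_numberOp_mul_numberOp (Λ := Λ)).dotProduct_mulVec_nonneg ψ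
  rw [sub_mulVec, smul_mulVec, one_mulVec, dotProduct_sub, dotProduct_smul] at h
  have h' := (Complex.nonneg_iff.1 h).1
  rw [Complex.sub_re] at h'
  have hre : (((Fintype.card Λ : ℕ) : ℂ) • (star ψ ⬝ᵥ ψ)).re =
      (Fintype.card Λ : ℝ) * (star ψ ⬝ᵥ ψ).re := by
    rw [smul_eq_mul, ← Complex.ofReal_natCast, Complex.re_ofReal_mul]
  linarith [hre]

/-- For a unit eigenvector with real eigenvalue `e`, `Re ⟨ψ, H ψ⟩ = e`. [folklore] -/
theorem re_expect_of_eigen {n : Type*} [Fintype n] {H : Matrix n n ℂ} {ψ : n → ℂ} {e : ℝ}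
    (hH : H *ᵥ ψ = ((e : ℝ) : ℂ) • ψ) (h1 : star ψ ⬝ᵥ ψ = 1) :
    (star ψ ⬝ᵥ H *ᵥ ψ).re = e := by
  rw [hH, dotProduct_smul, smul_eq_mul, h1, mul_one, Complex.ofReal_re]

end Energy

/-- **Variational upper bound on the interacting sector energy.** For `U ≥ 0` and `n ≤ L²`, on the
torus of side `L`: `minE(H(t,U), szSector (2n) 0) ≤ minE(H(t,0), szSector (2n) 0) + U · L²` (test
`H(t,U)` on a normalised free sector ground state; `Σ n↑n↓ ≤ L²`). Tasaki (2020) §2.2 (variational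
principle). [folklore] -/
theorem minEnergyOn_szSector_le_free_add (L : ℕ) (t U : ℝ) (hU : 0 ≤ U) {n : ℕ} (hn : n ≤ L ^ 2) :
    (hubbardTorus 2 L t U).minEnergyOn (szSector (Λ := FermionTorus 2 L) (2 * n) 0) ≤
      (hubbardTorus 2 L t 0).minEnergyOn (szSector (Λ := FermionTorus 2 L) (2 * n) 0) +
        U * (L : ℝ) ^ 2 := by
  obtain ⟨φ, hφ1, hφS, -, hHφ⟩ := NoGo.exists_unit_groundStateInSector_hubbardTorus L t 0 hn
  have hH : (hubbardTorus 2 L t U).IsHermitian := LiebThm1.hamiltonian_isHermitian _ t U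
  have hle := minEnergyOn_le_rayleigh_of_mem hH _ hφS hφ1
  have hsplit := re_expect_hamiltonian_eq (fermionTorusGraph 2 L) t U φ
  have hfree : (star φ ⬝ᵥ hubbardTorus 2 L t 0 *ᵥ φ).re =
      (hubbardTorus 2 L t 0).minEnergyOn (szSector (Λ := FermionTorus 2 L) (2 * n) 0) :=
    re_expect_of_eigen hHφ hφ1
  have hD := re_expect_interaction_le (Λ := FermionTorus 2 L) φ
  rw [NoGo.card_fermionTorus_two, hφ1, Complex.one_re, mul_one] at hD
  have hD' : U * (star φ ⬝ᵥ (∑ x : FermionTorus 2 L, numberOp x 0 * numberOp x 1 :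
      Matrix (Finset (Orb (FermionTorus 2 L))) _ ℂ) *ᵥ φ).re ≤ U * (L : ℝ) ^ 2 := by
    have := mul_le_mul_of_nonneg_left hD hU
    simpa using this
  unfold hubbardTorus at *
  linarith

/-- **The free energy of an interacting sector ground state.** For `U ≥ 0` and `n ≤ L²`, a
normalised ground state `ψ` of `hubbardTorus 2 L t U` in the sector `(2n, S^z = 0)` has
`Re ⟨ψ, H(t,0) ψ⟩ ≤ minE(H(t,0), sector) + U · L²`: its free-energy excess over the free sector
ground energy is at most `U L²` (`⟨H₀⟩_ψ = E₀(U) - U⟨D⟩_ψ ≤ E₀(U) ≤ E₀(0) + U L²`). [folklore] -/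
theorem re_free_energy_groundState_le (L : ℕ) (t U : ℝ) (hU : 0 ≤ U) {n : ℕ} (hn : n ≤ L ^ 2)
    {ψ : Fock (Orb (FermionTorus 2 L))}
    (hψ : IsGroundStateInSector (hubbardTorus 2 L t U) (2 * n) 0 ψ) (h1 : star ψ ⬝ᵥ ψ = 1) :
    (star ψ ⬝ᵥ hubbardTorus 2 L t 0 *ᵥ ψ).re ≤
      (hubbardTorus 2 L t 0).minEnergyOn (szSector (Λ := FermionTorus 2 L) (2 * n) 0) +
        U * (L : ℝ) ^ 2 := by
  obtain ⟨-, -, hHψ⟩ := hψ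
  have hU' : (star ψ ⬝ᵥ hubbardTorus 2 L t U *ᵥ ψ).re =
      (hubbardTorus 2 L t U).minEnergyOn (szSector (Λ := FermionTorus 2 L) (2 * n) 0) :=
    re_expect_of_eigen hHψ h1
  have hsplit := re_expect_hamiltonian_eq (fermionTorusGraph 2 L) t U ψ
  have hD := re_expect_interaction_nonneg (Λ := FermionTorus 2 L) ψ
  have hvar := minEnergyOn_szSector_le_free_add L t U hU hn
  have hUD : 0 ≤ U * (star ψ ⬝ᵥ (∑ x : FermionTorus 2 L, numberOp x 0 * numberOp x 1 :
      Matrix (Finset (Orb (FermionTorus 2 L))) _ ℂ) *ᵥ ψ).re :=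
    mul_nonneg hU hD
  unfold hubbardTorus at *
  linarith

/-! ### The window cannot reach `U → 0⁺` with a uniform constant -/

/-- **Window floor for `BirGroundStateAverageLRO` (load-bearing `0 < U₁`).** Suppose the crux's
average bound with constant `c` holds eventually in even `L` at EVERY coupling of an interval
`(U₁, U₂)` with `0 ≤ U₁ < U₂`, and suppose `η` is an energy-cost rate of `d`-wave pair LRO of
density `c` in the free Fermi sea from side `L₁` on: every unit vector `ψ` of a sector
`(N, S^z = 0)` with `Re ⟨ψ, Δ_d†Δ_d ψ⟩ ≥ c L⁴` has `Re ⟨ψ, H(1,0) ψ⟩ ≥ minE(H(1,0), sector) + η L²`.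
Then `η ≤ U₁`. Proof: otherwise pick `U ∈ (U₁, U₂)` with `U < η` and a large even side; the average
bound yields a normalised sector ground state of `H(1,U)` with `⟨Δ_d†Δ_d⟩ ≥ c L⁴` (tree,
`exists_groundState_le_of_trace_bound`), whose free-energy excess is `≤ U L² < η L²`
(`re_free_energy_groundState_le`) — contradiction. [folklore] -/
theorem birGroundStateAverageLRO_window_floor {δ U₁ U₂ c : ℝ}
    (hδ : δ ∈ Set.Ioo (0:ℝ) (1/2)) (hU₁ : 0 ≤ U₁) (hU : U₁ < U₂)
    (h : ∀ U ∈ Set.Ioo U₁ U₂, ∃ L₀ : ℕ, ∀ (L : ℕ) [NeZero L], L₀ ≤ L → Even L →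
      let N : ℕ := 2 * ⌊(1 - δ) * (L : ℝ) ^ 2 / 2⌋₊
      let H := hubbardTorus 2 L 1 U
      let S := szSector (Λ := FermionTorus 2 L) N 0
      let E₀ := S ⊓ Module.End.eigenspace (Matrix.toLin' H) ((H.minEnergyOn S : ℝ) : ℂ)
      let P := projMatrix (E₀.map (Fock.toEuclidean (ι := Orb (FermionTorus 2 L)) :
        Fock (Orb (FermionTorus 2 L)) →ₗ[ℂ] EuclideanSpace ℂ (Finset (Orb (FermionTorus 2 L)))))
      c * (L : ℝ) ^ 4 * P.trace.re ≤
        (P * ((pairField dWaveFormFactor L)ᴴ * pairField dWaveFormFactor L)).trace.re)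
    {η : ℝ} {L₁ : ℕ}
    (hη : ∀ (L : ℕ) [NeZero L], L₁ ≤ L → ∀ (N : ℕ) (ψ : Fock (Orb (FermionTorus 2 L))),
      ψ ∈ szSector (Λ := FermionTorus 2 L) N 0 → star ψ ⬝ᵥ ψ = 1 →
      c * (L : ℝ) ^ 4 ≤
        (star ψ ⬝ᵥ ((pairField dWaveFormFactor L)ᴴ * pairField dWaveFormFactor L) *ᵥ ψ).re →
      (hubbardTorus 2 L 1 0).minEnergyOn (szSector (Λ := FermionTorus 2 L) N 0) + η * (L : ℝ) ^ 2 ≤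
        (star ψ ⬝ᵥ (hubbardTorus 2 L 1 0) *ᵥ ψ).re) :
    η ≤ U₁ := by
  by_contra hlt
  push Not at hlt
  -- a coupling in the window below η
  set U := min ((U₁ + η) / 2) ((U₁ + U₂) / 2) with hUdef
  have hUmem : U ∈ Set.Ioo U₁ U₂ := by
    constructor
    · simp only [hUdef, lt_min_iff]; constructor <;> linarith
    · exact (min_le_right _ _).trans_lt (by linarith)
  have hUη : U < η := (min_le_left _ _).trans_lt (by linarith)
  have hU0 : 0 ≤ U := le_trans hU₁ hUmem.1.le
  obtain ⟨L₀, hL₀⟩ := h U hUmem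
  -- a large even side
  set m := max L₀ L₁ + 1 with hm
  haveI : NeZero (2 * m) := ⟨by omega⟩
  have hbound := hL₀ (2 * m) (by omega) (even_two_mul m)
  have hδ' : (-1 : ℝ) ≤ δ := by linarith [hδ.1]
  obtain ⟨ψ, hgs, h1, hle⟩ := exists_groundState_le_of_trace_bound (2 * m) 1 U δ c hδ' hbound
  have hn := NoGo.floor_pairNumber_le δ hδ' (2 * m)
  have hcost := hη (2 * m) (by omega) _ ψ hgs.1 h1 hle
  have hfree := re_free_energy_groundState_le (2 * m) 1 U hU0 hn hgs h1
  have hL : (0 : ℝ) < ((2 * m : ℕ) : ℝ) ^ 2 := by positivity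
  have hmul : η * ((2 * m : ℕ) : ℝ) ^ 2 ≤ U * ((2 * m : ℕ) : ℝ) ^ 2 := by linarith
  have := le_of_mul_le_mul_right hmul hL
  linarith

/-- **Refuted strengthening (window from `0`), modulo the free-fermion energy inequality.** Grant
the BCS-asymptotics hypothesis `hC` (spelled inline, NOT asserted by this file): for every LRO
density `a > 0` there are `η > 0`, `L₁` such that from side `L₁` on every unit vector of a sector
`(N, S^z = 0)` with `Re ⟨ψ, Δ_d†Δ_d ψ⟩ ≥ a L⁴` pays free energy `≥ η L²` above the free sector ground
energy (on paper: condensation energy of the zero-pair-momentum `d`-wave reduced BCS model is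
`o(g) L²`, Bogoliubov Jr.'s approximating-Hamiltonian theorem, Bru–de Siqueira Pedra, Mem. AMS 224
(2013) App. Thm 107; optimise the coupling `g`). THEN the strengthening of `BirGroundStateAverageLRO`
whose window is `(0, U₂)` with ONE constant `c` down to `U → 0⁺` is FALSE (`η(c) ≤ U₁ = 0 < η(c)`).
So `0 < U₁`, with `c` depending on the window, is load-bearing in the crux. [folklore] -/
theorem not_birGroundStateAverageLRO_fromZero_of_pairingCost
    (hC : ∀ a : ℝ, 0 < a → ∃ η : ℝ, 0 < η ∧ ∃ L₁ : ℕ, ∀ (L : ℕ) [NeZero L], L₁ ≤ L →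
      ∀ (N : ℕ) (ψ : Fock (Orb (FermionTorus 2 L))),
        ψ ∈ szSector (Λ := FermionTorus 2 L) N 0 → star ψ ⬝ᵥ ψ = 1 →
        a * (L : ℝ) ^ 4 ≤
          (star ψ ⬝ᵥ ((pairField dWaveFormFactor L)ᴴ * pairField dWaveFormFactor L) *ᵥ ψ).re →
        (hubbardTorus 2 L 1 0).minEnergyOn (szSector (Λ := FermionTorus 2 L) N 0) +
            η * (L : ℝ) ^ 2 ≤
          (star ψ ⬝ᵥ (hubbardTorus 2 L 1 0) *ᵥ ψ).re) :
    ¬ ∃ δ ∈ Set.Ioo (0:ℝ) (1/2), ∃ U₂ c : ℝ, 0 < U₂ ∧ 0 < c ∧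
        ∀ U ∈ Set.Ioo 0 U₂, ∃ L₀ : ℕ, ∀ (L : ℕ) [NeZero L], L₀ ≤ L → Even L →
          let N : ℕ := 2 * ⌊(1 - δ) * (L : ℝ) ^ 2 / 2⌋₊
          let H := hubbardTorus 2 L 1 U
          let S := szSector (Λ := FermionTorus 2 L) N 0
          let E₀ := S ⊓ Module.End.eigenspace (Matrix.toLin' H) ((H.minEnergyOn S : ℝ) : ℂ)
          let P := projMatrix (E₀.map (Fock.toEuclidean (ι := Orb (FermionTorus 2 L)) :
            Fock (Orb (FermionTorus 2 L)) →ₗ[ℂ]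
              EuclideanSpace ℂ (Finset (Orb (FermionTorus 2 L)))))
          c * (L : ℝ) ^ 4 * P.trace.re ≤
            (P * ((pairField dWaveFormFactor L)ᴴ * pairField dWaveFormFactor L)).trace.re := by
  rintro ⟨δ, hδ, U₂, c, hU₂, hc, hall⟩
  obtain ⟨η, hη, L₁, hcost⟩ := hC c hc
  have := birGroundStateAverageLRO_window_floor hδ le_rfl hU₂ hall (η := η) (L₁ := L₁)
    (fun L _ hL N ψ hS h1 hle => hcost L hL N ψ hS h1 hle)
  linarith

end Summit.HubbardSuperconductivity.HubbardSuperconductivity.Theorems.BirGroundStateAverageLRO.Negative
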